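import Summits.CriticalPhenomena.PercolationContinuityZ3.Theorems.PercNearOneGluingNoHeavyLowerTailStarSetFamilyRegUnits
import Summits.CriticalPhenomena.PercolationContinuityZ3.Theorems.PercNearOneGluingNoHeavyLowerTailStarSetFamilySwapOfUnits
import Summits.CriticalPhenomena.PercolationContinuityZ3.Theorems.PercNearOneGluingNoHeavyLowerTailStarSetFamilySwapJstar
import Summits.CriticalPhenomena.PercolationContinuityZ3.Theorems.PercNearOneGluingNoHeavyLowerTailStarSetSwapAdmissible
import HarnessLib

/-!
# `NoHeavyLowerTail` (stmt-CriticalPhenomena-4575) — the EARLY BOUND of the unit bound (U1-PROOF.md §§3–5; blueprint §G3/§G5/§G6)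

Support file (prover `prim-gen-swap` gen 14; `--supports stmt-CriticalPhenomena-4575`).  No definitions, no named facts, no sorries.

The charged units `(S, X)` of the configuration expansion (LEAN-BLUEPRINT-U1.md §C: `X ∈ Ω S`, and `X ≠ free S` when `y(S) = 1`) that fall in
one of the three EARLY families — A0 (`S` contains an r-free triangle), regular (U1-PROOF §3 A1/A2: a partner not hot at its free end),
swap (U1-PROOF §5: a C-hot port `d` of `X` whose swapped configuration `S − X + {r,d}` is a credit configuration) — are paid by the credit
configurations that are NOT pool targets (some class is neither an r-chord nor a child edge) plus `51/128` of the capacity of the r-free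
triangles and `1/2` of the capacity of the regular triples.  Everything is derived from chargedness alone: the child edge of a swap port is
not in `S` and the case datum of `swap_targets_one_port` holds (`|Ω S| ≥ 2` and `omega_star_of_no_triangle` when `y(S) = 1`, the least
forest class when `y(S) = 0`), and `S ∖ {X}` is never inside the pool (then `Ω S = {X}` and `y(S) = 1`, so `X` would be free).
The weight `W`, capacity `C`, `Ω`, the credit predicate and the free rule are PARAMETERS with their defining hypotheses; the resource
sets `TRIS ⊇ r-free triangles`, `REGT ⊇ regular triples` are parameters too (no deep `Finset.filter` predicates in the statement).

* `StarSet.adj_comm₄` — symmetry of the four-way adjacency disjunction;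
* `StarSet.familyReg_of_units'` — `familyReg_of_units` with the set of regular triples as a parameter;
* `StarSet.early_bound` — the early bound.
-/

namespace Summit.CriticalPhenomena.PercolationContinuityZ3.Theorems

open Finset
open scoped BigOperators Classical

namespace StarSet

variable {ι V : Type*} [Fintype ι] [LinearOrder ι] [DecidableEq V]

omit [Fintype ι] [LinearOrder ι] [DecidableEq V] in
/-- Symmetry of the adjacency disjunction. -/
theorem adj_comm₄ (P P' : ι → V) {X Y : ι} (h : P Y = P X ∨ P Y = P' X ∨ P' Y = P X ∨ P' Y = P' X) :
    P X = P Y ∨ P X = P' Y ∨ P' X = P Y ∨ P' X = P' Y := by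
  rcases h with h | h | h | h
  · exact Or.inl h.symm
  · exact Or.inr (Or.inr (Or.inl h.symm))
  · exact Or.inr (Or.inl h.symm)
  · exact Or.inr (Or.inr (Or.inr h.symm))

/-- `familyReg_of_units` with the set of regular triples as a parameter. -/
theorem familyReg_of_units' (P P' : ι → V) (hPP' : ∀ X, P X ≠ P' X) (r : V) (F : Finset ι)
    (θ : ι → ℝ) (hθ0 : ∀ X, 0 ≤ θ X) (hθ1 : ∀ X, θ X ≤ 1) (O : ι → V → ℝ) (hO0 : ∀ X d, 0 ≤ O X d) (Φ : ι → ℝ)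
    (hO2 : ∀ X, Φ X ^ 2 ≤ O X (P X) * O X (P' X)) (hΦ4 : ∀ X, 4 * θ X ≤ Φ X) (hΦsq : ∀ X, θ X ≤ Φ X ^ 2)
    (dom : ι → V → ι)
    (hdom : ∀ X ∉ F, ∀ d, (P X = d ∨ P' X = d) →
      dom X d ∈ F ∧ (P (dom X d) = d ∨ P' (dom X d) = d) ∧
        (∀ u, (P (dom X d) = u ∨ P' (dom X d) = u) → (P X = u ∨ P' X = u) → u = d) ∧ θ X ≤ θ (dom X d))
    (REGT : Finset (Finset ι))
    (hREGT : ∀ T : Finset ι, (∃ M E₁ E₂ : ι, ∃ q₁ q₂ f₁ f₂ : V,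
          M ∉ F ∧ (s(P M, P' M) : Sym2 V) = s(q₁, q₂) ∧ (s(P E₁, P' E₁) : Sym2 V) = s(q₁, f₁) ∧
          (s(P E₂, P' E₂) : Sym2 V) = s(q₂, f₂) ∧ q₁ ≠ q₂ ∧ f₁ ≠ q₁ ∧ f₁ ≠ q₂ ∧ f₂ ≠ q₁ ∧ f₂ ≠ q₂ ∧
          q₁ ≠ r ∧ q₂ ≠ r ∧ f₁ ≠ r ∧ f₂ ≠ r ∧ T = {M, E₁, E₂}) → T ∈ REGT)
    (U : Finset (Finset ι × ι))
    (hU : ∀ u ∈ U, u.2 ∈ u.1 ∧ u.2 ∉ F ∧ P u.2 ≠ r ∧ P' u.2 ≠ r ∧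
      (∀ Y ∈ u.1, P Y = P u.2 ∨ P Y = P' u.2 ∨ P' Y = P u.2 ∨ P' Y = P' u.2) ∧
      ∃ Y ∈ u.1, Y ≠ u.2 ∧ P Y ≠ r ∧ P' Y ≠ r ∧
        ((∃ p, (P u.2 = p ∨ P' u.2 = p) ∧ P Y ≠ p ∧ P' Y ≠ p ∧ P (dom u.2 p) ≠ r ∧ P' (dom u.2 p) ≠ r) ∨
         (Y ∉ F ∧ ∃ s', (P Y = s' ∨ P' Y = s') ∧ P u.2 ≠ s' ∧ P' u.2 ≠ s' ∧ P (dom Y s') ≠ r ∧ P' (dom Y s') ≠ r))) :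
    ∑ u ∈ U, ((∏ k ∈ u.1, θ k) * ∏ k ∈ univ \ u.1, (1 - θ k)) ≤
      (1 / 2) * ∑ T ∈ REGT,
        ∑ δ ∈ (univ : Finset (ι → Bool)).filter (fun δ => (∀ K ∉ T, δ K = false) ∧
            3 ≤ (T.image fun K => if δ K then P K else P' K).card ∧ r ∉ T.image fun K => if δ K then P K else P' K),
          ∏ K ∈ T, O K (if δ K then P K else P' K) := by
  refine (familyReg_of_units P P' hPP' r F θ hθ0 hθ1 O hO0 Φ hO2 hΦ4 hΦsq dom hdom U hU).trans ?_
  refine mul_le_mul_of_nonneg_left (sum_le_sum_of_subset_of_nonneg (fun T hT => hREGT T (mem_filter.1 hT).2)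
    fun T _ _ => sum_nonneg fun δ _ => prod_nonneg fun K _ => hO0 _ _) (by norm_num)


/-- **The EARLY BOUND (U1-PROOF §§3–5; blueprint §G3).**  See the file header.  `hU`: every unit of `U` is a charged unit
(`u.2 ∈ Ω u.1`, and `u.2 ≠ free u.1` when `y(u.1) = 1`) of one of the three early families (A0 ∨ regular ∨ swap). -/
theorem early_bound [Fintype V] (P P' : ι → V) (hPP' : ∀ X, P X ≠ P' X)
    (hinj : Function.Injective fun X => (s(P X, P' X) : Sym2 V)) (r : V) (F : Finset ι)
    (hforest : ∀ K ∈ F, ∀ I ∈ F, K < I → P' K ≠ P I ∧ P' K ≠ P' I)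
    (θ : ι → ℝ) (hθ0 : ∀ X, 0 ≤ θ X) (hθ1 : ∀ X, θ X < 1)
    (O : ι → V → ℝ) (hO0 : ∀ X d, 0 ≤ O X d) (Φ : ι → ℝ)
    (hO2 : ∀ X, Φ X ^ 2 ≤ O X (P X) * O X (P' X))
    (hΦ4 : ∀ X, 4 * θ X ≤ Φ X) (hΦsq : ∀ X, θ X ≤ Φ X ^ 2)
    (dom : ι → V → ι)
    (hdom : ∀ X ∉ F, ∀ d, (P X = d ∨ P' X = d) →
      dom X d ∈ F ∧ (P (dom X d) = d ∨ P' (dom X d) = d) ∧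
        (∀ u, (P (dom X d) = u ∨ P' (dom X d) = u) → (P X = u ∨ P' X = u) → u = d) ∧ θ X ≤ θ (dom X d))
    (W : Finset ι → ℝ) (hW : ∀ S, W S = (∏ k ∈ S, θ k) * ∏ k ∈ univ \ S, (1 - θ k))
    (C : Finset ι → ℝ) (hC : ∀ T, C T = ∑ δ ∈ (univ : Finset (ι → Bool)).filter (fun δ => (∀ K ∉ T, δ K = false) ∧
        3 ≤ (T.image fun K => if δ K then P K else P' K).card ∧ r ∉ T.image fun K => if δ K then P K else P' K),
      ∏ K ∈ T, O K (if δ K then P K else P' K))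
    (Ω : Finset ι → Finset ι) (hΩ : ∀ S, Ω S = S.filter (fun X => X ∈ (univ \ F).filter (fun κ => P κ ≠ r ∧ P' κ ≠ r) ∧
        ∀ Y ∈ S, (P Y = P X ∨ P Y = P' X ∨ P' Y = P X ∨ P' Y = P' X)))
    (cred : Finset ι → Prop) (hcred : ∀ S, cred S ↔ Ω S = ∅ ∧
      ((∀ I ∈ F, I ∉ S) ∨ ∃ a ∈ F, P a = r ∧ a ∈ S ∧ ∀ b ∈ F, b < a → b ∉ S))
    (free : Finset ι → ι) (hfree : ∀ S, (Ω S).Nonempty → free S ∈ Ω S)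
    (TRIS : Finset (Finset ι))
    (hTRIS : ∀ (a b c : V) (X Y Z : ι), a ≠ b → a ≠ c → b ≠ c → a ≠ r → b ≠ r → c ≠ r →
      (s(P X, P' X) : Sym2 V) = s(a, b) → (s(P Y, P' Y) : Sym2 V) = s(a, c) → (s(P Z, P' Z) : Sym2 V) = s(b, c) →
      ({X, Y, Z} : Finset ι) ∈ TRIS)
    (REGT : Finset (Finset ι))
    (hREGT : ∀ T : Finset ι, (∃ M E₁ E₂ : ι, ∃ q₁ q₂ f₁ f₂ : V,
          M ∉ F ∧ (s(P M, P' M) : Sym2 V) = s(q₁, q₂) ∧ (s(P E₁, P' E₁) : Sym2 V) = s(q₁, f₁) ∧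
          (s(P E₂, P' E₂) : Sym2 V) = s(q₂, f₂) ∧ q₁ ≠ q₂ ∧ f₁ ≠ q₁ ∧ f₁ ≠ q₂ ∧ f₂ ≠ q₁ ∧ f₂ ≠ q₂ ∧
          q₁ ≠ r ∧ q₂ ≠ r ∧ f₁ ≠ r ∧ f₂ ≠ r ∧ T = {M, E₁, E₂}) → T ∈ REGT)
    (U : Finset (Finset ι × ι))
    (hU : ∀ u ∈ U, u.2 ∈ Ω u.1 ∧
      (((∀ I ∈ F, I ∉ u.1) ∨ ∃ a ∈ F, P a = r ∧ a ∈ u.1 ∧ ∀ b ∈ F, b < a → b ∉ u.1) → u.2 ≠ free u.1) ∧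
      ((∃ a b c : V, a ≠ b ∧ a ≠ c ∧ b ≠ c ∧ a ≠ r ∧ b ≠ r ∧ c ≠ r ∧
          (∃ X ∈ u.1, (s(P X, P' X) : Sym2 V) = s(a, b)) ∧ (∃ Y ∈ u.1, (s(P Y, P' Y) : Sym2 V) = s(a, c)) ∧
            ∃ Z ∈ u.1, (s(P Z, P' Z) : Sym2 V) = s(b, c)) ∨
       (∃ Y ∈ u.1, Y ≠ u.2 ∧ P Y ≠ r ∧ P' Y ≠ r ∧
          ((∃ p, (P u.2 = p ∨ P' u.2 = p) ∧ P Y ≠ p ∧ P' Y ≠ p ∧ P (dom u.2 p) ≠ r ∧ P' (dom u.2 p) ≠ r) ∨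
           (Y ∉ F ∧ ∃ s', (P Y = s' ∨ P' Y = s') ∧ P u.2 ≠ s' ∧ P' u.2 ≠ s' ∧ P (dom Y s') ≠ r ∧ P' (dom Y s') ≠ r))) ∨
       (∃ d, (P u.2 = d ∨ P' u.2 = d) ∧ P (dom u.2 d) = r ∧ (∃ Y ∈ u.1, P Y ≠ d ∧ P' Y ≠ d) ∧
          cred (insert (dom u.2 d) (u.1.erase u.2))))) :
    ∑ u ∈ U, W u.1 ≤
      ∑ S ∈ (univ : Finset ι).powerset.filter (fun S => cred S ∧
          ∃ K ∈ S, ¬ ((K ∉ F ∧ (P K = r ∨ P' K = r)) ∨ (K ∈ F ∧ P K = r))), W S +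
        (51 / 128) * ∑ T ∈ TRIS, C T + (1 / 2) * ∑ T ∈ REGT, C T := by
  -- abbreviations
  set y1 : Finset ι → Prop := fun S => (∀ I ∈ F, I ∉ S) ∨ ∃ a ∈ F, P a = r ∧ a ∈ S ∧ ∀ b ∈ F, b < a → b ∉ S with hy1
  set A0 : Finset ι → Prop := fun S => ∃ a b c : V, a ≠ b ∧ a ≠ c ∧ b ≠ c ∧ a ≠ r ∧ b ≠ r ∧ c ≠ r ∧
      (∃ X ∈ S, (s(P X, P' X) : Sym2 V) = s(a, b)) ∧ (∃ Y ∈ S, (s(P Y, P' Y) : Sym2 V) = s(a, c)) ∧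
        ∃ Z ∈ S, (s(P Z, P' Z) : Sym2 V) = s(b, c) with hA0
  set reg : Finset ι × ι → Prop := fun u => ∃ Y ∈ u.1, Y ≠ u.2 ∧ P Y ≠ r ∧ P' Y ≠ r ∧
      ((∃ p, (P u.2 = p ∨ P' u.2 = p) ∧ P Y ≠ p ∧ P' Y ≠ p ∧ P (dom u.2 p) ≠ r ∧ P' (dom u.2 p) ≠ r) ∨
       (Y ∉ F ∧ ∃ s', (P Y = s' ∨ P' Y = s') ∧ P u.2 ≠ s' ∧ P' u.2 ≠ s' ∧ P (dom Y s') ≠ r ∧ P' (dom Y s') ≠ r))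
    with hreg
  set adm : Finset ι × ι → V → Prop := fun u d => (P u.2 = d ∨ P' u.2 = d) ∧ P (dom u.2 d) = r ∧
      (∃ Y ∈ u.1, P Y ≠ d ∧ P' Y ≠ d) ∧ cred (insert (dom u.2 d) (u.1.erase u.2)) with hadm
  have hθ1' : ∀ X, θ X ≤ 1 := fun X => (hθ1 X).le
  have hW0 : ∀ S, 0 ≤ W S := fun S => by
    rw [hW]; exact mul_nonneg (prod_nonneg fun k _ => hθ0 k) (prod_nonneg fun k _ => sub_nonneg.2 (hθ1' k))
  have hC0 : ∀ T, 0 ≤ C T := fun T => by rw [hC]; exact sum_nonneg fun δ _ => prod_nonneg fun K _ => hO0 _ _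
  have hΩmem : ∀ S X, X ∈ Ω S ↔ X ∈ S ∧ (X ∉ F ∧ P X ≠ r ∧ P' X ≠ r) ∧
      ∀ Y ∈ S, (P Y = P X ∨ P Y = P' X ∨ P' Y = P X ∨ P' Y = P' X) := by
    intro S X
    rw [hΩ S, mem_filter, mem_filter, mem_sdiff]
    simp only [mem_univ, true_and]
  -- (0) a charged unit's configuration is not inside the pool away from the hub
  have hnotpool : ∀ u ∈ U, ∃ K ∈ u.1, K ≠ u.2 ∧ ¬ ((K ∉ F ∧ (P K = r ∨ P' K = r)) ∨ (K ∈ F ∧ P K = r)) := by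
    intro u hu
    obtain ⟨hXΩ, hch, -⟩ := hU u hu
    obtain ⟨hXS, ⟨hXF, hXr, hX'r⟩, -⟩ := (hΩmem _ _).1 hXΩ
    by_contra hcon
    push Not at hcon
    have hΩeq : ∀ X' ∈ Ω u.1, X' = u.2 := by
      intro X' hX'
      obtain ⟨hX'S, ⟨hX'F, hX'r, hX'r'⟩, -⟩ := (hΩmem _ _).1 hX'
      by_contra hne
      rcases hcon X' hX'S hne with ⟨-, h | h⟩ | ⟨hF', -⟩
      · exact hX'r h
      · exact hX'r' h
      · exact hX'F hF'
    have hy : y1 u.1 := by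
      by_cases h0 : ∀ I ∈ F, I ∉ u.1
      · exact Or.inl h0
      · push Not at h0
        obtain ⟨I, hIF, hIS⟩ := h0
        have hne : (u.1.filter (· ∈ F)).Nonempty := ⟨I, mem_filter.2 ⟨hIS, hIF⟩⟩
        have ha := min'_mem _ hne
        refine Or.inr ⟨(u.1.filter (· ∈ F)).min' hne, (mem_filter.1 ha).2, ?_, (mem_filter.1 ha).1, fun b hbF hba hbS => ?_⟩
        · have haX : (u.1.filter (· ∈ F)).min' hne ≠ u.2 := fun h => hXF (h ▸ (mem_filter.1 ha).2)
          rcases hcon _ (mem_filter.1 ha).1 haX with ⟨hnF, -⟩ | ⟨-, hP⟩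
          · exact absurd (mem_filter.1 ha).2 hnF
          · exact hP
        · exact absurd (min'_le _ b (mem_filter.2 ⟨hbS, hbF⟩)) (not_le.2 hba)
    exact hch hy (hΩeq _ (hfree u.1 ⟨u.2, hXΩ⟩)).symm
  -- (1) the three families
  set U₁ := U.filter (fun u => A0 u.1) with hU₁
  set U₂ := (U.filter (fun u => ¬ A0 u.1)).filter (fun u => reg u) with hU₂
  set U₃ := (U.filter (fun u => ¬ A0 u.1)).filter (fun u => ¬ reg u) with hU₃
  have hsplit : ∑ u ∈ U, W u.1 = ∑ u ∈ U₁, W u.1 + ∑ u ∈ U₂, W u.1 + ∑ u ∈ U₃, W u.1 := by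
    rw [← sum_filter_add_sum_filter_not U (fun u => A0 u.1),
      ← sum_filter_add_sum_filter_not (U.filter (fun u => ¬ A0 u.1)) (fun u => reg u), add_assoc]
  -- (1a) A0
  have hA0part : ∑ u ∈ U₁, W u.1 ≤ (3 / 128) * ∑ T ∈ TRIS, C T := by
    have h := familyA0_of_units P P' hPP' hinj r θ hθ0 hθ1' O hO0 Φ hO2 hΦ4 U₁ (fun u hu => by
      obtain ⟨huU, htri⟩ := mem_filter.1 hu
      obtain ⟨hXΩ, -, -⟩ := hU u huU
      obtain ⟨hXS, -, hadj⟩ := (hΩmem _ _).1 hXΩ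
      exact ⟨hXS, hadj, htri⟩)
    rw [sum_congr rfl fun u _ => hW u.1]
    refine h.trans (mul_le_mul_of_nonneg_left ?_ (by norm_num))
    rw [sum_congr rfl fun T _ => hC T]
    refine sum_le_sum_of_subset_of_nonneg (fun T hT => ?_) fun T _ _ => ?_
    · obtain ⟨a, b, c, X, Y, Z, hab, hac, hbc, har, hbr, hcr, rfl, hX, hY, hZ⟩ := (mem_filter.1 hT).2
      exact hTRIS a b c X Y Z hab hac hbc har hbr hcr hX hY hZ
    · exact sum_nonneg fun δ _ => prod_nonneg fun K _ => hO0 _ _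
  -- (1b) regular
  have hregpart : ∑ u ∈ U₂, W u.1 ≤ (1 / 2) * ∑ T ∈ REGT, C T := by
    have h := familyReg_of_units' P P' hPP' r F θ hθ0 hθ1' O hO0 Φ hO2 hΦ4 hΦsq dom hdom REGT hREGT U₂ (fun u hu => by
      obtain ⟨hu', hregu⟩ := mem_filter.1 hu
      obtain ⟨huU, -⟩ := mem_filter.1 hu'
      obtain ⟨hXΩ, -, -⟩ := hU u huU
      obtain ⟨hXS, ⟨hXF, hXr, hX'r⟩, hadj⟩ := (hΩmem _ _).1 hXΩ
      exact ⟨hXS, hXF, hXr, hX'r, hadj, hregu⟩)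
    rw [sum_congr rfl fun u _ => hW u.1]
    refine h.trans (le_of_eq ?_)
    rw [sum_congr rfl fun T _ => (hC T).symm]
  -- (1c) swap
  have hΦpart : ∑ u ∈ U₃, W u.1 ≤
      ∑ S ∈ (univ : Finset ι).powerset.filter (fun S => cred S ∧
          ∃ K ∈ S, ¬ ((K ∉ F ∧ (P K = r ∨ P' K = r)) ∨ (K ∈ F ∧ P K = r))), W S + (3 / 8) * ∑ T ∈ TRIS, C T := by
    -- every unit of U₃ has an admissible port
    have hadmex : ∀ u ∈ U₃, ∃ d, adm u d := by
      intro u hu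
      obtain ⟨hu', hnreg⟩ := mem_filter.1 hu
      obtain ⟨huU, hnA0⟩ := mem_filter.1 hu'
      obtain ⟨-, -, hearly⟩ := hU u huU
      rcases hearly with h | h | h
      · exact absurd h hnA0
      · exact absurd h hnreg
      · exact h
    by_cases hU₃e : U₃ = ∅
    · rw [hU₃e, sum_empty]
      exact add_nonneg (sum_nonneg fun S _ => hW0 S) (mul_nonneg (by norm_num) (sum_nonneg fun T _ => hC0 T))
    obtain ⟨u₀, hu₀⟩ := nonempty_iff_ne_empty.2 hU₃e
    haveI : Nonempty V := ⟨r⟩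
    choose! prt hprt using hadmex
    -- the child edge at a port
    have hchild : ∀ d : V, ∃ I : ι, (∃ I' ∈ F, P I' = r ∧ P' I' = d) → (I ∈ F ∧ P I = r ∧ P' I = d) := by
      intro d
      by_cases h : ∃ I' ∈ F, P I' = r ∧ P' I' = d
      · obtain ⟨I', hI'F, hI'⟩ := h
        exact ⟨I', fun _ => ⟨hI'F, hI'⟩⟩
      · exact ⟨u₀.2, fun h' => absurd h' h⟩
    choose child hchild using hchild
    -- unit data common to all swap units
    have hdata : ∀ u ∈ U₃, u ∈ U ∧ ¬ A0 u.1 ∧ u.2 ∈ u.1 ∧ u.2 ∉ F ∧ P u.2 ≠ r ∧ P' u.2 ≠ r ∧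
        (∀ Y ∈ u.1, P Y = P u.2 ∨ P Y = P' u.2 ∨ P' Y = P u.2 ∨ P' Y = P' u.2) ∧
        (P u.2 = prt u ∨ P' u.2 = prt u) ∧ child (prt u) ∈ F ∧ P (child (prt u)) = r ∧ P' (child (prt u)) = prt u ∧
        child (prt u) = dom u.2 (prt u) ∧ θ u.2 ≤ θ (child (prt u)) ∧ (∃ Y ∈ u.1, P Y ≠ prt u ∧ P' Y ≠ prt u) ∧
        cred (insert (child (prt u)) (u.1.erase u.2)) := by
      intro u hu
      obtain ⟨hu', -⟩ := mem_filter.1 hu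
      obtain ⟨huU, hnA0⟩ := mem_filter.1 hu'
      obtain ⟨hXΩ, -, -⟩ := hU u huU
      obtain ⟨hXS, ⟨hXF, hXr, hX'r⟩, hadj⟩ := (hΩmem _ _).1 hXΩ
      obtain ⟨hXd, hdomr, hY, hcredt⟩ := hprt u hu
      obtain ⟨hdF, hdd, -, hθd⟩ := hdom u.2 hXF (prt u) hXd
      have hdr : prt u ≠ r := by
        rcases hXd with h | h
        · rw [← h]; exact hXr
        · rw [← h]; exact hX'r
      have hd' : P' (dom u.2 (prt u)) = prt u := by
        rcases hdd with h | h
        · exact absurd (hdomr.symm.trans h) hdr.symm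
        · exact h
      obtain ⟨hcF, hcr, hcd⟩ := hchild (prt u) ⟨dom u.2 (prt u), hdF, hdomr, hd'⟩
      have hcdom : child (prt u) = dom u.2 (prt u) := rclass_eq_of_ports P P' hinj ⟨hcr, hcd⟩ ⟨hdomr, hd'⟩
      refine ⟨huU, hnA0, hXS, hXF, hXr, hX'r, hadj, hXd, hcF, hcr, hcd, hcdom, hcdom ▸ hθd, hY, ?_⟩
      rw [hcdom]; exact hcredt
    have h := familySwap_of_units P P' hPP' hinj r F hforest θ hθ0 hθ1' O hO0 Φ hO2 hΦ4 hΦsq TRIS hTRIS U₃ prt child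
      (fun u hu => by
        obtain ⟨huU, hnA0, hXS, hXF, hXr, hX'r, hadj, hXd, hcF, hcr, hcd, hcdom, hθc, hY, hcredt⟩ := hdata u hu
        obtain ⟨hXΩ, hch, -⟩ := hU u huU
        obtain ⟨hΩt, hy1t⟩ := (hcred _).1 hcredt
        refine ⟨hXS, hXF, hXr, hX'r, fun Y hY => adj_comm₄ P P' (hadj Y hY), hXd, hcF, hcr, hcd, ?_, hθc, hY, ?_⟩
        · -- the child edge is not in the configuration
          by_cases hy : y1 u.1
          · -- `y(S) = 1`: `|Ω S| ≥ 2`, STAR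
            intro hAS
            have hfS := hfree u.1 ⟨u.2, hXΩ⟩
            have hcard : 2 ≤ (Ω u.1).card := by
              have hsub : ({u.2, free u.1} : Finset ι) ⊆ Ω u.1 := by
                intro K hK
                rcases mem_insert.1 hK with rfl | hK
                · exact hXΩ
                · rw [mem_singleton.1 hK]; exact hfS
              have := card_le_card hsub
              rwa [card_pair (hch hy)] at this
            obtain ⟨Y, hYS, hYd, hY'd⟩ := hY
            exact swap_child_not_mem_of_star P P' hPP' hinj r u.1 (Ω u.1) (fun K hK => ((hΩmem _ _).1 hK).1) hcard
              (fun K hK => ⟨((hΩmem _ _).1 hK).2.1.2.1, ((hΩmem _ _).1 hK).2.1.2.2⟩)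
              (fun K hK Y hY => adj_comm₄ P P' (((hΩmem _ _).1 hK).2.2 Y hY)) hnA0 hAS ⟨hcr, hcd⟩ hYS ⟨hYd, hY'd⟩
          · -- `y(S) = 0`: the least forest class `J ∉ Ch`
            have h0 : ¬ ∀ I ∈ F, I ∉ u.1 := fun h => hy (Or.inl h)
            push Not at h0
            obtain ⟨I, hIF, hIS⟩ := h0
            have hne : (u.1.filter (· ∈ F)).Nonempty := ⟨I, mem_filter.2 ⟨hIS, hIF⟩⟩
            have hJ := min'_mem _ hne
            have hJmin : ∀ I ∈ u.1, I ∈ F → (u.1.filter (· ∈ F)).min' hne ≤ I :=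
              fun I hI hIF => min'_le _ I (mem_filter.2 ⟨hI, hIF⟩)
            have hJr : P ((u.1.filter (· ∈ F)).min' hne) ≠ r := fun hJr =>
              hy (Or.inr ⟨_, (mem_filter.1 hJ).2, hJr, (mem_filter.1 hJ).1, fun b hbF hbJ hbS =>
                absurd (hJmin b hbS hbF) (not_le.2 hbJ)⟩)
            exact swap_child_not_mem_of_jstar P r F hXF (mem_filter.1 hJ).1 (mem_filter.1 hJ).2 hJmin hJr hcF hy1t
        · -- the case datum of `swap_targets_one_port`
          by_cases hy : y1 u.1
          · left
            have hfS := hfree u.1 ⟨u.2, hXΩ⟩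
            have hcard : 2 ≤ (Ω u.1).card := by
              have hsub : ({u.2, free u.1} : Finset ι) ⊆ Ω u.1 := by
                intro K hK
                rcases mem_insert.1 hK with rfl | hK
                · exact hXΩ
                · rw [mem_singleton.1 hK]; exact hfS
              have := card_le_card hsub
              rwa [card_pair (hch hy)] at this
            exact swap_hcase_star P P' hPP' hinj r F u.1 (Ω u.1) (fun K hK => ((hΩmem _ _).1 hK).1) hcard
              (fun K hK => ⟨((hΩmem _ _).1 hK).2.1.2.1, ((hΩmem _ _).1 hK).2.1.2.2⟩)
              (fun K hK => ((hΩmem _ _).1 hK).2.1.1)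
              (fun K hK Y hY => adj_comm₄ P P' (((hΩmem _ _).1 hK).2.2 Y hY)) hnA0 u.2
          · right
            have h0 : ¬ ∀ I ∈ F, I ∉ u.1 := fun h => hy (Or.inl h)
            push Not at h0
            obtain ⟨I, hIF, hIS⟩ := h0
            have hne : (u.1.filter (· ∈ F)).Nonempty := ⟨I, mem_filter.2 ⟨hIS, hIF⟩⟩
            have hJ := min'_mem _ hne
            have hJmin : ∀ I ∈ u.1, I ∈ F → (u.1.filter (· ∈ F)).min' hne ≤ I :=
              fun I hI hIF => min'_le _ I (mem_filter.2 ⟨hI, hIF⟩)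
            have hJr : P ((u.1.filter (· ∈ F)).min' hne) ≠ r := fun hJr =>
              hy (Or.inr ⟨_, (mem_filter.1 hJ).2, hJr, (mem_filter.1 hJ).1, fun b hbF hbJ hbS =>
                absurd (hJmin b hbS hbF) (not_le.2 hbJ)⟩)
            exact ⟨_, (mem_filter.1 hJ).1, (mem_filter.1 hJ).2, hJmin, hJr,
              swap_child_lt_jstar P r F hXF (mem_filter.1 hJ).1 (mem_filter.1 hJ).2 hJmin hJr hy1t⟩)
    rw [sum_congr rfl fun u _ => hW u.1]
    refine h.trans (add_le_add ?_ (le_of_eq ?_))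
    · -- the targets are non-pool credit configurations
      rw [sum_congr rfl fun ω _ => (hW ω).symm]
      refine sum_le_sum_of_subset_of_nonneg (fun ω hω => ?_) fun S _ _ => hW0 S
      obtain ⟨u, hu, rfl⟩ := mem_image.1 hω
      obtain ⟨huU, -, -, -, -, -, -, -, -, -, -, -, -, -, hcredt⟩ := hdata u hu
      obtain ⟨K, hKS, hKX, hK⟩ := hnotpool u huU
      exact mem_filter.2 ⟨mem_powerset.2 (subset_univ _), hcredt, K,
        mem_insert_of_mem (mem_erase.2 ⟨hKX, hKS⟩), hK⟩
    · rw [sum_congr rfl fun T _ => (hC T).symm]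
  rw [hsplit]
  linarith [hA0part, hregpart, hΦpart]

end StarSet

end Summit.CriticalPhenomena.PercolationContinuityZ3.Theorems
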